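import Literature.Probability.Percolation.ChayesLeiHexProofs
import Literature.Probability.Percolation.TriDiscInterface
import Literature.Probability.Percolation.PolylineTransitFaces
import HarnessLib

/-!
# Route CardyBondTriangular · crux `BondTriangularCardy` · line `birth`: the kite-interface toolkit, I — kite darts

Helper of the stub `stub_clDuality` (the Chayes–Lei duality lemma = existence half of
Bollobás–Riordan's Lemma 5, *Percolation* (2006) Ch. 7 p. 169, for the hexagon model with
half-edge connectivity of Chayes–Lei, Rev. Math. Phys. 19 (2007) §2.1), and of the Claim-10 blue
arm (`stub_blueArm`). This file is the COLOUR-GENERIC part of the interface-following machinery on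
the **kite tiling**: the hexagon `H_x` of a site `x : Site 2` of `𝕋` is cut by its three split
lines (joining midpoints of opposite edges) into six kites `K(x, F)`, one for each corner `F` of
`H_x`; we index the corners of `H_x` anticlockwise by `k : Fin 6` as `leftFaceDir x k` (the face of
`𝕋` to the left of the dart `x → x + triDir k`, at angle `60k + 30°`), so a **kite** is a pair
`(x, k) : Site 2 × Fin 6`. The edge of `H_x` crossed by `x → x + triDir k` joins the corners
`k + 5` (clockwise end) and `k` (anticlockwise end); seen from the neighbour `y = x + triDir k` these
corners are `leftFaceDir y (k + 3)` and `leftFaceDir y (k + 2)`.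

Every edge of the kite tiling has a midpoint of an edge of `H` as one endpoint; the other is a
corner (a "spoke", half an edge of `H`) or a hexagon centre (half a split line). A **kite dart**
`⟨x, k, kind⟩ : Dart` is an oriented kite edge at the midpoint of the edge `k` of `H_x`:
`spokeIn` (midpoint → corner `leftFaceDir x k`), `spokeOut` (that corner → midpoint), `splitIn`
(centre of `x` → midpoint), `splitOut` (midpoint → centre of `x`); every oriented kite edge has
exactly one such name. `Dart.R`/`Dart.L` are the kites on its right/left. Given ANY colouring
`c : Site 2 → Fin 6 → Bool` of the kites (`true` = yellow), a dart is an **interface dart**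
(`IsIface`) when its right kite is yellow and its left kite blue, and `succ c d` is the next
interface dart: turn about the head vertex of `d` through the yellow kites following `R d`
anticlockwise (at a centre: straight across, the rule for the three admissible split hexagons).
Proved here: the successor of an interface dart is an interface dart (at a centre this needs the
hypothesis `CentreOK`, true for Chayes–Lei states, file II), and — with no hypothesis at all — two
interface darts with the same successor are equal (`succ_injective`), which is what makes the
followed interface a simple path. The colouring by a configuration on a marked domain, the
boundary bookkeeping and the crossing invariants are files II–IV
(`…KiteColour`, `…KiteInvariant`, `…KiteDuality`).

References: B. Bollobás, O. Riordan, *Percolation*, CUP 2006, Ch. 7 Lemma 5 pp. 169–171, Fig. 9;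
L. Chayes, H. K. Lei, Rev. Math. Phys. 19 (2007) §2.1 ("only three of the six possible split
hexagons occur").
-/

namespace Summit.CriticalPhenomena.CardyFormulaZ2.Theorems.BondTriangularCardyLine.Kite

open Literature.Probability.Percolation Literature.Probability.LatticeModels

/-! ### Lattice bookkeeping: corners and edges of a hexagon by direction

(The corner `k` of `H_x` is the corner `k + 2` of the neighbour across the edge `k`:
`leftFaceDir_add_triDir` of `PolylineTransitFaces.lean`; opposite directions: `triDir_add_three`.) -/

/-- The corner `k + 5` of `H_x` is the corner `k + 3` of the neighbour across the edge `k`. -/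
theorem leftFaceDir_add_triDir_add_three (x : Site 2) (k : Fin 6) :
    leftFaceDir (x + triDir k) (k + 3) = leftFaceDir x (k + 5) := by
  fin_cases k <;> simp [leftFaceDir, triDir, sub_eq_add_neg, add_assoc, add_comm, add_left_comm]

/-- The corner `k` of `H_x` is the corner `k + 4` of the third hexagon `x + triDir (k + 1)` at it. -/
theorem leftFaceDir_add_triDir_succ_add_four (x : Site 2) (k : Fin 6) :
    leftFaceDir (x + triDir (k + 1)) (k + 4) = leftFaceDir x k := by
  fin_cases k <;> simp [leftFaceDir, triDir, sub_eq_add_neg, add_assoc, add_comm, add_left_comm]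

/-- Two sides of a face: `x + triDir k + triDir (k + 2) = x + triDir (k + 1)`. -/
@[simp] theorem add_triDir_add_triDir_add_two (x : Site 2) (k : Fin 6) :
    x + triDir k + triDir (k + 2) = x + triDir (k + 1) := by
  rw [add_assoc, triDir_add_triDir_add_two]

/-- `x + triDir (k + 1) + triDir (k + 4) = x`. -/
@[simp] theorem add_triDir_succ_add_triDir_add_four (x : Site 2) (k : Fin 6) :
    x + triDir (k + 1) + triDir (k + 4) = x := by
  rw [show k + 4 = k + 1 + 3 by rw [add_assoc]; rfl, triDir_add_three, add_neg_cancel_right]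

/-- `x + triDir (k + 1) + triDir (k + 5) = x + triDir k`. -/
@[simp] theorem add_triDir_succ_add_triDir_add_five (x : Site 2) (k : Fin 6) :
    x + triDir (k + 1) + triDir (k + 5) = x + triDir k := by
  have h := triDir_add_triDir_add_two (k + 5)
  rw [show k + 5 + 2 = k + 1 by rw [add_assoc]; exact congrArg _ (by decide),
    show k + 5 + 1 = k by rw [add_assoc]; exact add_eq_left.2 (by decide)] at h
  rw [add_assoc, add_comm (triDir (k + 1)), h]

/-- `x + triDir k + triDir (k + 4) = x + triDir (k + 5)`. -/
@[simp] theorem add_triDir_add_triDir_add_four (x : Site 2) (k : Fin 6) :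
    x + triDir k + triDir (k + 4) = x + triDir (k + 5) := by
  have h := triDir_add_triDir_add_two (k + 4)
  rw [show k + 4 + 2 = k by rw [add_assoc]; exact add_eq_left.2 (by decide),
    show k + 4 + 1 = k + 5 by rw [add_assoc]; rfl] at h
  rw [add_assoc, add_comm (triDir k), h]

/-- **Registered anchor of this file** (`kite_corner_across_edge`): the two corners of the edge `k`
of `H_x` seen from the neighbour across it — the corner `k` is its corner `k + 2`, the corner
`k + 5` its corner `k + 3`. -/
theorem kite_corner_across_edge : ∀ (x : Literature.Probability.LatticeModels.Site 2) (k : Fin 6), Literature.Probability.Percolation.leftFaceDir (x + Literature.Probability.Percolation.triDir k) (k + 2) = Literature.Probability.Percolation.leftFaceDir x k ∧ Literature.Probability.Percolation.leftFaceDir (x + Literature.Probability.Percolation.triDir k) (k + 3) = Literature.Probability.Percolation.leftFaceDir x (k + 5) :=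
  fun x k => ⟨leftFaceDir_add_triDir x k, leftFaceDir_add_triDir_add_three x k⟩

/-! ### Kite darts -/

/-- The four kinds of oriented kite edges at the midpoint of a hexagon edge. -/
inductive Kind : Type
  /-- midpoint → corner (along half an edge of `H`) -/
  | spokeIn : Kind
  /-- corner → midpoint -/
  | spokeOut : Kind
  /-- centre → midpoint (along half a split line) -/
  | splitIn : Kind
  /-- midpoint → centre -/
  | splitOut : Kind
  deriving DecidableEq

/-- **A kite dart**: the oriented kite edge of kind `kind` at the midpoint of the edge `k` of the
hexagon `x` (the spokes are those to the corner `leftFaceDir x k`, the split half-lines those of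
`H_x`). -/
structure Dart : Type where
  /-- the hexagon -/
  x : Site 2
  /-- the edge of `H_x`, by the direction of the neighbour across it -/
  k : Fin 6
  /-- the kind -/
  kind : Kind
  deriving DecidableEq

namespace Dart

/-- **The kite on the right** of a dart (moving along it). -/
def R : Dart → Site 2 × Fin 6
  | ⟨x, k, .spokeIn⟩ => (x + triDir k, k + 2)
  | ⟨x, k, .spokeOut⟩ => (x, k)
  | ⟨x, k, .splitIn⟩ => (x, k + 5)
  | ⟨x, k, .splitOut⟩ => (x, k)

/-- **The kite on the left** of a dart. -/
def L : Dart → Site 2 × Fin 6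
  | ⟨x, k, .spokeIn⟩ => (x, k)
  | ⟨x, k, .spokeOut⟩ => (x + triDir k, k + 2)
  | ⟨x, k, .splitIn⟩ => (x, k)
  | ⟨x, k, .splitOut⟩ => (x, k + 5)

end Dart

variable (c : Site 2 → Fin 6 → Bool)

/-- **The interface darts** of a kite colouring: yellow kite on the right, blue kite on the left. -/
def iface : Set Dart := {d | c d.R.1 d.R.2 = true ∧ c d.L.1 d.L.2 = false}

variable {c} in
/-- Interface darts, unfolded. -/
theorem mem_iface {d : Dart} : d ∈ iface c ↔ c d.R.1 d.R.2 = true ∧ c d.L.1 d.L.2 = false := Iff.rfl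

/-- **The next dart along the oriented interface**: at the head vertex of `d`, sweep
anticlockwise from the right kite through yellow kites and leave before the first blue one
(at a hexagon centre: straight across, the split line of an admissible split hexagon). -/
def succ : Dart → Dart
  | ⟨x, k, .spokeOut⟩ =>
      if c x (k + 5) = false then ⟨x, k, .splitOut⟩
      else if c (x + triDir k) (k + 3) = false then ⟨x + triDir k, k + 3, .spokeIn⟩
      else ⟨x + triDir k, k + 3, .splitOut⟩
  | ⟨x, k, .splitIn⟩ =>
      if c (x + triDir k) (k + 3) = false then ⟨x + triDir k, k + 3, .spokeIn⟩
      else if c (x + triDir k) (k + 2) = false then ⟨x + triDir k, k + 3, .splitOut⟩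
      else ⟨x, k, .spokeIn⟩
  | ⟨x, k, .spokeIn⟩ =>
      if c (x + triDir (k + 1)) (k + 4) = false then ⟨x + triDir k, k + 2, .spokeOut⟩
      else ⟨x + triDir (k + 1), k + 4, .spokeOut⟩
  | ⟨x, k, .splitOut⟩ => ⟨x, k + 3, .splitIn⟩

/-- **The hexagons where the centre rule holds**: a yellow kite followed clockwise by a blue one is
the first of three consecutive yellow kites followed by three blue ones (the colouring of `H_x` is
that of an admissible Chayes–Lei state). -/
def centreOK : Set (Site 2) :=
  {x | ∀ k : Fin 6, c x k = true → c x (k + 5) = false →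
    c x (k + 1) = true ∧ c x (k + 2) = true ∧ c x (k + 3) = false ∧ c x (k + 4) = false}

/-! ### Small `Fin 6` facts -/

/-- `k + 3 + 3 = k`. -/
@[simp] theorem fin6_add_three_add_three (k : Fin 6) : k + 3 + 3 = k := by
  rw [add_assoc]; exact add_eq_left.2 (by decide)

/-- `k + 3 + 2 = k + 5`. -/
@[simp] theorem fin6_add_three_add_two (k : Fin 6) : k + 3 + 2 = k + 5 := by rw [add_assoc]; rfl

/-- `k + 3 + 5 = k + 2`. -/
@[simp] theorem fin6_add_three_add_five (k : Fin 6) : k + 3 + 5 = k + 2 := by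
  rw [add_assoc]; exact congrArg _ (by decide)

/-- `k + 2 + 1 = k + 3`. -/
@[simp] theorem fin6_add_two_add_one (k : Fin 6) : k + 2 + 1 = k + 3 := by rw [add_assoc]; rfl

/-- `k + 2 + 4 = k`. -/
@[simp] theorem fin6_add_two_add_four (k : Fin 6) : k + 2 + 4 = k := by
  rw [add_assoc]; exact add_eq_left.2 (by decide)

/-- `k + 4 + 1 = k + 5`. -/
@[simp] theorem fin6_add_four_add_one (k : Fin 6) : k + 4 + 1 = k + 5 := by rw [add_assoc]; rfl

/-- `k + 4 + 2 = k`. -/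
@[simp] theorem fin6_add_four_add_two (k : Fin 6) : k + 4 + 2 = k := by
  rw [add_assoc]; exact add_eq_left.2 (by decide)

/-- `k + 4 + 4 = k + 2`. -/
@[simp] theorem fin6_add_four_add_four (k : Fin 6) : k + 4 + 4 = k + 2 := by
  rw [add_assoc]; exact congrArg _ (by decide)

/-- `k + 5 + 1 = k`. -/
@[simp] theorem fin6_add_five_add_one (k : Fin 6) : k + 5 + 1 = k := by
  rw [add_assoc]; exact add_eq_left.2 (by decide)

/-! ### The successor of an interface dart is an interface dart -/

variable {c}

/-- Leaving a corner: the next dart is an interface dart. -/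
theorem isIface_succ_spokeOut {x : Site 2} {k : Fin 6} (h : ⟨x, k, .spokeOut⟩ ∈ iface c) :
    (succ c ⟨x, k, .spokeOut⟩) ∈ iface c := by
  obtain ⟨hR, hL⟩ := h
  simp only [Dart.R, Dart.L] at hR hL
  simp only [succ]
  split_ifs with h1 h2
  · exact ⟨hR, h1⟩
  · refine ⟨?_, h2⟩
    simp only [Dart.R, triDir_add_three, add_neg_cancel_right, fin6_add_three_add_two]
    simpa using h1
  · refine ⟨by simpa [Dart.R] using h2, ?_⟩
    simp only [Dart.L, fin6_add_three_add_five]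
    exact hL

/-- Arriving at a midpoint from a centre: the next dart is an interface dart. -/
theorem isIface_succ_splitIn {x : Site 2} {k : Fin 6} (h : ⟨x, k, .splitIn⟩ ∈ iface c) :
    (succ c ⟨x, k, .splitIn⟩) ∈ iface c := by
  obtain ⟨hR, hL⟩ := h
  simp only [Dart.R, Dart.L] at hR hL
  simp only [succ]
  split_ifs with h1 h2
  · refine ⟨?_, h1⟩
    simp only [Dart.R, triDir_add_three, add_neg_cancel_right, fin6_add_three_add_two]
    exact hR
  · refine ⟨by simpa [Dart.R] using h1, ?_⟩
    simp only [Dart.L, fin6_add_three_add_five]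
    exact h2
  · exact ⟨by simpa [Dart.R] using h2, hL⟩

/-- Arriving at a corner: the next dart is an interface dart. -/
theorem isIface_succ_spokeIn {x : Site 2} {k : Fin 6} (h : ⟨x, k, .spokeIn⟩ ∈ iface c) :
    (succ c ⟨x, k, .spokeIn⟩) ∈ iface c := by
  obtain ⟨hR, hL⟩ := h
  simp only [Dart.R, Dart.L] at hR hL
  simp only [succ]
  split_ifs with h1
  · refine ⟨hR, ?_⟩
    simp only [Dart.L, add_triDir_add_triDir_add_two]
    rw [show k + 2 + 2 = k + 4 by rw [add_assoc]; rfl]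
    exact h1
  · refine ⟨by simpa [Dart.R] using h1, ?_⟩
    simp only [Dart.L, add_triDir_succ_add_triDir_add_four, fin6_add_four_add_two]
    exact hL

/-- Arriving at a centre where the centre rule holds: the next dart is an interface dart. -/
theorem isIface_succ_splitOut {x : Site 2} {k : Fin 6} (h : ⟨x, k, .splitOut⟩ ∈ iface c) (hx : x ∈ centreOK c) :
    (succ c ⟨x, k, .splitOut⟩) ∈ iface c := by
  obtain ⟨hR, hL⟩ := h
  simp only [Dart.R, Dart.L] at hR hL
  obtain ⟨-, h2, h3, -⟩ := hx k hR hL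
  exact ⟨by simpa [succ, Dart.R] using h2, by simpa [succ, Dart.L] using h3⟩

/-! ### Predecessors: the interface map is injective on interface darts -/

/-- Only the centre step produces a `splitIn` dart. -/
theorem eq_of_succ_eq_splitIn {d : Dart} {x : Site 2} {k : Fin 6} (h : succ c d = ⟨x, k, .splitIn⟩) :
    d = ⟨x, k + 3, .splitOut⟩ := by
  rcases d with ⟨x', k', κ⟩
  cases κ <;> simp only [succ] at h
  · split_ifs at h <;> simp at h
  · split_ifs at h <;> simp at h
  · split_ifs at h <;> simp at h
  · simp only [Dart.mk.injEq, and_true] at h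
    obtain ⟨rfl, rfl⟩ := h
    simp

/-- The three ways of producing a `splitOut` dart, told apart by the two kites across the edge. -/
theorem eq_of_succ_eq_splitOut {d : Dart} {y : Site 2} {k : Fin 6} (hd : d ∈ iface c)
    (h : succ c d = ⟨y, k, .splitOut⟩) :
    (d = ⟨y, k, .spokeOut⟩ ∧ c (y + triDir k) (k + 2) = false) ∨
      (d = ⟨y + triDir k, k + 3, .spokeOut⟩ ∧ c (y + triDir k) (k + 3) = true ∧ c (y + triDir k) (k + 2) = true) ∨
      (d = ⟨y + triDir k, k + 3, .splitIn⟩ ∧ c (y + triDir k) (k + 2) = true ∧ c (y + triDir k) (k + 3) = false) := by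
  rcases d with ⟨x', k', κ⟩
  obtain ⟨hR, hL⟩ := hd
  cases κ <;> simp only [succ] at h
  · split_ifs at h <;> simp at h
  · split_ifs at h with h1 h2
    · simp only [Dart.mk.injEq, and_true] at h
      obtain ⟨rfl, rfl⟩ := h
      exact Or.inl ⟨rfl, by simpa [Dart.L] using hL⟩
    · simp at h
    · simp only [Dart.mk.injEq, and_true] at h
      obtain ⟨rfl, rfl⟩ := h
      right; left
      simp only [Dart.R] at hR
      refine ⟨by simp [triDir_add_three], ?_, ?_⟩
      · simpa [triDir_add_three] using hR
      · simpa [triDir_add_three] using h1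
  · split_ifs at h with h1 h2
    · simp at h
    · simp only [Dart.mk.injEq, and_true] at h
      obtain ⟨rfl, rfl⟩ := h
      right; right
      simp only [Dart.R, Dart.L] at hR hL
      exact ⟨by simp [triDir_add_three], by simpa [triDir_add_three] using hR, by simpa [triDir_add_three] using hL⟩
    · simp at h
  · simp at h

/-- The three ways of producing a `spokeIn` dart, told apart by two kites. -/
theorem eq_of_succ_eq_spokeIn {d : Dart} {y : Site 2} {k : Fin 6} (hd : d ∈ iface c)
    (h : succ c d = ⟨y, k, .spokeIn⟩) :
    (d = ⟨y + triDir k, k + 3, .spokeOut⟩ ∧ c (y + triDir k) (k + 3) = true ∧ c y (k + 5) = false) ∨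
      (d = ⟨y + triDir k, k + 3, .splitIn⟩ ∧ c (y + triDir k) (k + 3) = false) ∨
      (d = ⟨y, k, .splitIn⟩ ∧ c (y + triDir k) (k + 3) = true ∧ c y (k + 5) = true) := by
  rcases d with ⟨x', k', κ⟩
  obtain ⟨hR, hL⟩ := hd
  simp only [Dart.R, Dart.L] at hR hL
  cases κ <;> simp only [succ] at h
  · split_ifs at h <;> simp at h
  · split_ifs at h with h1 h2
    · simp at h
    · simp only [Dart.mk.injEq, and_true] at h
      obtain ⟨rfl, rfl⟩ := h
      left
      exact ⟨by simp [triDir_add_three], by simpa [triDir_add_three] using hR, by simpa [triDir_add_three] using hL⟩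
    · simp at h
  · split_ifs at h with h1 h2
    · simp only [Dart.mk.injEq, and_true] at h
      obtain ⟨rfl, rfl⟩ := h
      right; left
      exact ⟨by simp [triDir_add_three], by simpa [triDir_add_three] using hL⟩
    · simp at h
    · simp only [Dart.mk.injEq, and_true] at h
      obtain ⟨rfl, rfl⟩ := h
      right; right
      exact ⟨rfl, by simpa [triDir_add_three] using h1, hR⟩
  · simp at h

/-- The two ways of producing a `spokeOut` dart, told apart by the third kite at the corner. -/
theorem eq_of_succ_eq_spokeOut {d : Dart} {y : Site 2} {k : Fin 6} (hd : d ∈ iface c)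
    (h : succ c d = ⟨y, k, .spokeOut⟩) :
    (d = ⟨y + triDir (k + 1), k + 4, .spokeIn⟩ ∧ c (y + triDir (k + 1)) (k + 4) = false) ∨
      (d = ⟨y + triDir k, k + 2, .spokeIn⟩ ∧ c (y + triDir (k + 1)) (k + 4) = true) := by
  rcases d with ⟨x', k', κ⟩
  obtain ⟨hR, hL⟩ := hd
  simp only [Dart.R, Dart.L] at hR hL
  cases κ <;> simp only [succ] at h
  · split_ifs at h with h1
    · simp only [Dart.mk.injEq, and_true] at h
      obtain ⟨rfl, rfl⟩ := h
      left
      refine ⟨?_, ?_⟩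
      · simp [show k' + 2 + 1 = k' + 3 from fin6_add_two_add_one k', show k' + 2 + 4 = k' from fin6_add_two_add_four k',
          triDir_add_three]
      · simpa [show k' + 2 + 1 = k' + 3 from fin6_add_two_add_one k', show k' + 2 + 4 = k' from fin6_add_two_add_four k',
          triDir_add_three] using hL
    · simp only [Dart.mk.injEq, and_true] at h
      obtain ⟨rfl, rfl⟩ := h
      right
      refine ⟨?_, ?_⟩
      · simp
      · simpa using hR
  · split_ifs at h <;> simp at h
  · split_ifs at h <;> simp at h
  · simp at h

/-- **The interface map is injective on interface darts** (no hypothesis on the colouring). -/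
theorem succ_injective {d₁ d₂ : Dart} (h₁ : d₁ ∈ iface c) (h₂ : d₂ ∈ iface c) (h : succ c d₁ = succ c d₂) :
    d₁ = d₂ := by
  rcases e : succ c d₂ with ⟨y, k, κ⟩
  rw [e] at h
  cases κ
  · rcases eq_of_succ_eq_spokeIn h₁ h with ⟨rfl, a1, a2⟩ | ⟨rfl, a1⟩ | ⟨rfl, a1, a2⟩ <;>
      rcases eq_of_succ_eq_spokeIn h₂ e with ⟨rfl, b1, b2⟩ | ⟨rfl, b1⟩ | ⟨rfl, b1, b2⟩ <;>
      simp_all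
  · rcases eq_of_succ_eq_spokeOut h₁ h with ⟨rfl, a1⟩ | ⟨rfl, a1⟩ <;>
      rcases eq_of_succ_eq_spokeOut h₂ e with ⟨rfl, b1⟩ | ⟨rfl, b1⟩ <;> simp_all
  · rw [eq_of_succ_eq_splitIn h, eq_of_succ_eq_splitIn e]
  · rcases eq_of_succ_eq_splitOut h₁ h with ⟨rfl, a1⟩ | ⟨rfl, a1, a2⟩ | ⟨rfl, a1, a2⟩ <;>
      rcases eq_of_succ_eq_splitOut h₂ e with ⟨rfl, b1⟩ | ⟨rfl, b1, b2⟩ | ⟨rfl, b1, b2⟩ <;>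
      simp_all

end Summit.CriticalPhenomena.CardyFormulaZ2.Theorems.BondTriangularCardyLine.Kite
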